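/-
COR-CM (cells pub-hodgecm / pub-hodgecm2, stage 2 of the Hodge ladder) — TRANSPOSITION SURGE, item (vi) sub-binder S2 / (vi-2)
`supply`, TEAM hCMisogE WAVE 2 (hcmisog-lead 19:37:42Z «TWO WAVES»): the packaged READING display.  Seat prover-pub-hodgecm2-hcmisog-glue-0
= (G) GLUE, ONE writer of this path.  Theorems only: no definition, no instance, no named fact, nothing asserted, no proof holes.  Binder
texts COPIED token for token from pin-3's staged display `Item6SupplyPinnedAssembly.lean` v4 (7ee352789537).  Imported BY NAME, never
edited or restated: `Item6PinMatchDef45Reading.lean` (this team's reading layer), pin-2's `Item6PinMatch.lean`, pin-1's `Item6PinReach.lean`,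
own-htheta's `Item6SupplyPinned.lean`.  Decl names carry the `_pinnedE_def45Reading` suffix.  FRAMING: HC_CM is NOT proved.
-/
import Summits.HodgeConjecture.CorCM.B01.Transposition.Item6PinMatchDef45Reading
import Summits.HodgeConjecture.CorCM.B01.Transposition.Item6SupplyPinned
import Summits.HodgeConjecture.CorCM.B01.Transposition.Item6PinMatch
import Summits.HodgeConjecture.CorCM.B01.Transposition.Item6PinReach
import Literature.AlgebraicGeometry.Motives.AbelianVarietyProjective
import HarnessLib

/-!
# Item (vi) S2 at the E-rational pin — the CM side as ONE reading binder («each object is a [Liu 2021, Def. 4.5 (2)] CM datum») + ONE cite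

WAVE 1 (`Item6SupplyPinnedDef45.lean`) replaced the identification binder `hCMisogE` of pin-3's display by Liu's Def. 4.5 (2) data on the
pin (`i`, `hdim`, `hdet45`), the base-change law `hdetBC` and the cite `hW` (its FINAL form
`Item6SupplyPinnedDef45Final.lean` uses the two tree theorems instead).  WAVE 2 (this file) PACKAGES the data: the carrier
`C : Def45.Carriers` (⟨CARRIER⟩ bullets 2–4 of Def. 4.5 (2)) and ONE reading binder `hAμ` («for every object of the consumer's
`𝒜(μ)`-carrier there is `X : Def45.CMDatum …` — the as-printed typing of [Liu2021] Def. 4.5 (2), `FJcycle.tex` l. 1944–1958 — with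
`X.A = Aμ₀ F ι₁ V Φ D_μ`»), with `hdetBC` DISCHARGED in the kernel by b17's `AbelianVariety.det_cotangentMap_baseChange`, and the Hodge comparison
`cotangent_hodge10_comparison` DISCHARGED by TRACK 2's kernel `cotangent_hodge10_comparison_holds` — NO cite binder left on the CM side.  KERNEL, BY NAME: `Model.hCMisogE_of_def45Reading` (`Item6PinMatchDef45Reading.lean`).
STRENGTH: `hAμ` packages exactly {`i`, `hdim`, `hdet45`} plus the ⟨CARRIER⟩ components; the referee's order (AUDIT v1.2) has this display
as a COROLLARY of wave 1 (it consumes more: the `Eq` of varieties in `hAμ`), kept for the record of the as-printed typing.  HC_CM is NOT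
proved; NOT claimed: that Liu's objects are constructed, that `hComp` / `hD` / `hAμ` are inhabited.

References: Y. Liu, arXiv:2102.11518 (`FJcycle.tex` md5 6db49a74122d) Def. 4.5 l. 1936–1964, Prop. 4.6 (1) l. 1966–1969, Thm. 4.18
l. 2232–2245; G. Shimura, *Abelian Varieties with Complex Multiplication and Modular Functions* (1998) §5.2, §7.1 Prop. 7.
-/

noncomputable section

open scoped TensorProduct InnerProductSpace

namespace Summit.HodgeConjecture.CorCM.Model
open CategoryTheory CategoryTheory.Limits AlgebraicGeometry NumberField
open Literature.AlgebraicGeometry.Motives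
open Literature.AlgebraicGeometry.ShimuraVarieties
open Literature.AlgebraicGeometry.Motives.HodgeStructure (conj)
open Literature.AlgebraicGeometry.HodgeTheory
open Literature.AlgebraicGeometry.ComplexMultiplication (IsCMTypeRealisation)
open Literature.NumberTheory.ComplexMultiplication
open Literature.NumberTheory.Automorphic
open Literature.NumberTheory.Automorphic.IdeleClassGroup
open Literature.NumberTheory.Automorphic.PicardCM
open Literature.NumberTheory.Automorphic.Liu2021

/-! ## §1  The junction and the END display, CM side = ONE reading binder `hAμ` -/

section Display

/-- **B01-S from [Liu 2021, Thm. 4.18] AS PRINTED at the E-rational pin, CM side = ONE reading binder** (WAVE 2 of TEAM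
hCMisogE; `U = picardCMUniverse hHD hI h₁ h₃`).  This is `Model.faceSupply_of_thm418AsPrinted_pinnedE_def45` (`Item6SupplyPinnedDef45.lean`)
with its four CM-side replacements `i`, `hdim`, `hdet45`, `hdetBC` PACKAGED: the carrier `C` (the ⟨CARRIER⟩ components of Def. 4.5 (2):
bullet 2 «CM character = `μ^{alg}`» l. 1952, `λ_μ` l. 1953–1955, `r_μ` l. 1955–1958) and the READING binder `hAμ` — «every object `D_μ` of
the consumer's `𝒜(μ)`-carrier is a CM datum `(A_μ, i_μ, λ_μ, r_μ) ∈ 𝒜(μ)` in the AS-PRINTED typing `Def45.CMDatum` ([Liu2021] Def. 4.5 (2),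
`FJcycle.tex` l. 1944–1958) whose first component is the pin's `Aμ₀ F ι₁ V Φ D_μ`» — the base-change law being DISCHARGED by b17's kernel
`AbelianVariety.det_cotangentMap_baseChange` and the Hodge comparison by TRACK 2's kernel
`cotangent_hodge10_comparison_holds` — both used BY NAME.  Every other carrier/binder is
pin-3's, token for token.  KERNEL: `Model.hCMisogE_of_def45Reading` (this team's (G) reading layer over hcmisog-isog-2's
`Model.exists_isogeny_isCMTypeRealisation_baseChange_of_cmDatum`).  HC_CM is NOT proved; `hAμ` (inhabited at a general face by
[Liu2021] Prop. 4.6 (1), l. 1966–1969, read on the as-printed typing — not in the tree), `hLiu`, `hComp` are hypotheses.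
[cite: Liu2021, Thm. 4.18 (FJcycle.tex l. 2232–2245), Def. 4.5 (1)–(2) (l. 1936–1958) and Prop. 4.6 (1) (l. 1966–1969)] -/
theorem faceSupply_of_thm418AsPrinted_pinnedE_def45Reading
    (hHD : exists_isReal_hodgeModel) (hI : hodgePQ_independent_of_hodgeModel)
    (h₁ : BallQuotientUniformised) (h₃ : CMAbelianVarietyRealised)
    (D : ∀ (F : CMField) (ι₁ : F →+* ℂ) (_ : HermSpace3 F ι₁) (_ : CMType F), Thm418Data (maximalRealSubfield F) F)
    (Aμ₀ : ∀ (F : CMField) (ι₁ : F →+* ℂ) (V : HermSpace3 F ι₁) (Φ : CMType F), (D F ι₁ V Φ).Obj → AbelianVariety F)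
    (AK : ∀ (F : CMField) (ι₁ : F →+* ℂ) (V : HermSpace3 F ι₁) (Φ : CMType F), Subgroup (D F ι₁ V Φ).G → AbelianVariety F)
    (homE : ∀ (F : CMField) (ι₁ : F →+* ℂ) (V : HermSpace3 F ι₁) (Φ : CMType F) (K : Subgroup (D F ι₁ V Φ).G)
      (Dμ : (D F ι₁ V Φ).Obj), (D F ι₁ V Φ).HomK K Dμ →+ ℚ ⊗[ℤ] (AK F ι₁ V Φ K ⟶ Aμ₀ F ι₁ V Φ Dμ))
    (hE : ∀ (F : CMField) (ι₁ : F →+* ℂ) (V : HermSpace3 F ι₁) (Φ : CMType F) (K : Subgroup (D F ι₁ V Φ).G)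
      (Dμ : (D F ι₁ V Φ).Obj), Function.Injective (homE F ι₁ V Φ K Dμ))
    (hLiu : ∀ (F : CMField), IsGalois ℚ F → 6 ≤ Module.finrank ℚ F → ∀ (Φ : CMType F) (ι₁ : F →+* ℂ), ι₁ ∈ Φ.1 →
      ∀ V : HermSpace3 F ι₁, Thm418AsPrinted (D F ι₁ V Φ))
    (hObj : ∀ (F : CMField), IsGalois ℚ F → 6 ≤ Module.finrank ℚ F → ∀ (Φ : CMType F) (ι₁ : F →+* ℂ), ι₁ ∈ Φ.1 →
      ∀ V : HermSpace3 F ι₁, Nonempty (D F ι₁ V Φ).Obj)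
    (hChi : ∀ (F : CMField), IsGalois ℚ F → 6 ≤ Module.finrank ℚ F → ∀ (Φ : CMType F) (ι₁ : F →+* ℂ), ι₁ ∈ Φ.1 →
      ∀ V : HermSpace3 F ι₁, Nonempty (D F ι₁ V Φ).Chi)
    (hirr : ∀ (F : CMField), IsGalois ℚ F → 6 ≤ Module.finrank ℚ F → ∀ (Φ : CMType F) (ι₁ : F →+* ℂ), ι₁ ∈ Φ.1 →
      ∀ (V : HermSpace3 F ι₁) (i : (D F ι₁ V Φ).AdmIndex), ((D F ι₁ V Φ).rhoAt i).IsIrreducible)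
    (hsm : ∀ (F : CMField), IsGalois ℚ F → 6 ≤ Module.finrank ℚ F → ∀ (Φ : CMType F) (ι₁ : F →+* ℂ), ι₁ ∈ Φ.1 →
      ∀ (V : HermSpace3 F ι₁) (i : (D F ι₁ V Φ).AdmIndex) (v : (D F ι₁ V Φ).omegaAt i),
        ∃ S : Subgroup (D F ι₁ V Φ).G, IsOpen (S : Set (D F ι₁ V Φ).G) ∧ ∀ k ∈ S, (D F ι₁ V Φ).rhoAt i k v = v)
    (hμ : ∀ (F : CMField), IsGalois ℚ F → 6 ≤ Module.finrank ℚ F → ∀ (Φ : CMType F) (ι₁ : F →+* ℂ), ι₁ ∈ Φ.1 →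
      ∀ (V : HermSpace3 F ι₁) (g : F ≃ₐ[ℚ] F),
        ι₁.comp (g : F →+* F) ∈ (D F ι₁ V Φ).cmType.1 ↔ ι₁.comp (g.symm : F →+* F) ∈ Φ.1)
    (C : ∀ (F : CMField) (ι₁ : F →+* ℂ) (V : HermSpace3 F ι₁) (Φ : CMType F), Def45.Carriers F (D F ι₁ V Φ).μ)
    (hAμ : ∀ (F : CMField) [IsGalois ℚ F], 6 ≤ Module.finrank ℚ F → ∀ (Φ : CMType F) (ι₁ : F →+* ℂ), ι₁ ∈ Φ.1 →
      ∀ (V : HermSpace3 F ι₁) (Dμ : (D F ι₁ V Φ).Obj),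
        ∃ X : Def45.CMDatum (AlgHom.id ℚ F) ι₁ (D F ι₁ V Φ).isConjugateSymplectic (D F ι₁ V Φ).hasWeight_one
          (C F ι₁ V Φ), X.A = Aμ₀ F ι₁ V Φ Dμ)
    (hComp : ∀ (F : CMField), IsGalois ℚ F → 6 ≤ Module.finrank ℚ F → ∀ (Φ : CMType F) (ι₁ : F →+* ℂ), ι₁ ∈ Φ.1 →
      ∀ V : HermSpace3 F ι₁, ∃ Ksm : Subgroup (D F ι₁ V Φ).G, IsOpenCompact Ksm ∧
        ∀ K : Subgroup (D F ι₁ V Φ).G, IsOpenCompact K → K ≤ Ksm →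
          ∃ (C : Type) (_ : Fintype C) (X : C → SchemeOver ℂ) (B : ∀ c, UnitaryBallUniformisationDatum 2 (X c))
            (Γ : C → Level V) (𝒥 : ∀ c, Jacobian (X c))
            (π : ∀ c, (letI := ι₁.toAlgebra; (AK F ι₁ V Φ K).baseChange ℂ) ⟶ (𝒥 c).J),
            (∀ c, (B c).Hℂ = V.Hm.map ι₁) ∧
            (∀ c, (B c).Γ.map (Matrix.GeneralLinearGroup.map (B c).τ₁) =
              (Γ c).Γ.map (Matrix.GeneralLinearGroup.map ι₁)) ∧
            Nonempty (IsLimit (Fan.mk (letI := ι₁.toAlgebra; (AK F ι₁ V Φ K).baseChange ℂ) π))) :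
    (picardCMUniverse hHD hI h₁ h₃).FaceSupply :=
  faceSupply_of_thm418AsPrinted_pinned_isog hHD hI h₁ h₃ D
    (fun F ι₁ V Φ Dμ => letI := ι₁.toAlgebra; (Aμ₀ F ι₁ V Φ Dμ).baseChange ℂ)
    hLiu hObj hChi hirr hsm hμ (fun F _ h6 Φ ι₁ hι V Dμ => hCMisogE_of_def45Reading D Aμ₀ C hAμ F h6 Φ ι₁ hι V Dμ)
    (pinReach_of_componentPinE h₁ h₃ D AK Aμ₀ homE hE hComp)

/-- **END DISPLAY at the E-rational pin, CM side = ONE reading binder** (`hU : U = U_rec`, instantiate with `rfl`):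
`Model.hc_cm_of_thm418AsPrinted_pinnedE_def45` with `{i, hdim, hdet45, hdetBC}` packaged into the carrier `C : Def45.Carriers` and the
READING binder `hAμ` («each object is a [Liu2021] Def. 4.5 (2) CM datum, as-printed typing `Def45.CMDatum`, whose `A_μ` is the pin»),
the base-change law (b17) and the Hodge comparison (TRACK 2) being kernel theorems used by name.  Binder set = pin-3's
`Model.hc_cm_of_thm418AsPrinted_pinnedE_isog` MINUS `hCMisogE` PLUS {`hAμ`} over the extra carrier `C`.  HC_CM is NOT proved: `hComp`, `hD`, `hAμ`, the cite binder `hLiu` and the Liu-side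
carriers are hypotheses, not inhabited here. [cite: Liu2021, Thm. 4.18 (FJcycle.tex l. 2232–2245), Def. 4.5 (2) (l. 1944–1958) and Prop. 4.6 (1) (l. 1966–1969)] -/
theorem hc_cm_of_thm418AsPrinted_pinnedE_def45Reading (U : Universe)
    (hU : U = picardCMUniverse exists_isReal_hodgeModel_holds hodgePQ_independent_of_hodgeModel_holds
      BallQuotient.ballQuotientUniformised_holds cmAbelianVarietyRealised_holds)
    (D : ∀ (F : CMField) (ι₁ : F →+* ℂ) (_ : HermSpace3 F ι₁) (_ : CMType F), Thm418Data (maximalRealSubfield F) F)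
    (Aμ₀ : ∀ (F : CMField) (ι₁ : F →+* ℂ) (V : HermSpace3 F ι₁) (Φ : CMType F), (D F ι₁ V Φ).Obj → AbelianVariety F)
    (AK : ∀ (F : CMField) (ι₁ : F →+* ℂ) (V : HermSpace3 F ι₁) (Φ : CMType F), Subgroup (D F ι₁ V Φ).G → AbelianVariety F)
    (homE : ∀ (F : CMField) (ι₁ : F →+* ℂ) (V : HermSpace3 F ι₁) (Φ : CMType F) (K : Subgroup (D F ι₁ V Φ).G)
      (Dμ : (D F ι₁ V Φ).Obj), (D F ι₁ V Φ).HomK K Dμ →+ ℚ ⊗[ℤ] (AK F ι₁ V Φ K ⟶ Aμ₀ F ι₁ V Φ Dμ))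
    (hE : ∀ (F : CMField) (ι₁ : F →+* ℂ) (V : HermSpace3 F ι₁) (Φ : CMType F) (K : Subgroup (D F ι₁ V Φ).G)
      (Dμ : (D F ι₁ V Φ).Obj), Function.Injective (homE F ι₁ V Φ K Dμ))
    (hLiu : ∀ (F : CMField), IsGalois ℚ F → 6 ≤ Module.finrank ℚ F → ∀ (Φ : CMType F) (ι₁ : F →+* ℂ), ι₁ ∈ Φ.1 →
      ∀ V : HermSpace3 F ι₁, Thm418AsPrinted (D F ι₁ V Φ))
    (hObj : ∀ (F : CMField), IsGalois ℚ F → 6 ≤ Module.finrank ℚ F → ∀ (Φ : CMType F) (ι₁ : F →+* ℂ), ι₁ ∈ Φ.1 →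
      ∀ V : HermSpace3 F ι₁, Nonempty (D F ι₁ V Φ).Obj)
    (hChi : ∀ (F : CMField), IsGalois ℚ F → 6 ≤ Module.finrank ℚ F → ∀ (Φ : CMType F) (ι₁ : F →+* ℂ), ι₁ ∈ Φ.1 →
      ∀ V : HermSpace3 F ι₁, Nonempty (D F ι₁ V Φ).Chi)
    (hirr : ∀ (F : CMField), IsGalois ℚ F → 6 ≤ Module.finrank ℚ F → ∀ (Φ : CMType F) (ι₁ : F →+* ℂ), ι₁ ∈ Φ.1 →
      ∀ (V : HermSpace3 F ι₁) (i : (D F ι₁ V Φ).AdmIndex), ((D F ι₁ V Φ).rhoAt i).IsIrreducible)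
    (hsm : ∀ (F : CMField), IsGalois ℚ F → 6 ≤ Module.finrank ℚ F → ∀ (Φ : CMType F) (ι₁ : F →+* ℂ), ι₁ ∈ Φ.1 →
      ∀ (V : HermSpace3 F ι₁) (i : (D F ι₁ V Φ).AdmIndex) (v : (D F ι₁ V Φ).omegaAt i),
        ∃ S : Subgroup (D F ι₁ V Φ).G, IsOpen (S : Set (D F ι₁ V Φ).G) ∧ ∀ k ∈ S, (D F ι₁ V Φ).rhoAt i k v = v)
    (hμ : ∀ (F : CMField), IsGalois ℚ F → 6 ≤ Module.finrank ℚ F → ∀ (Φ : CMType F) (ι₁ : F →+* ℂ), ι₁ ∈ Φ.1 →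
      ∀ (V : HermSpace3 F ι₁) (g : F ≃ₐ[ℚ] F),
        ι₁.comp (g : F →+* F) ∈ (D F ι₁ V Φ).cmType.1 ↔ ι₁.comp (g.symm : F →+* F) ∈ Φ.1)
    (C : ∀ (F : CMField) (ι₁ : F →+* ℂ) (V : HermSpace3 F ι₁) (Φ : CMType F), Def45.Carriers F (D F ι₁ V Φ).μ)
    (hAμ : ∀ (F : CMField) [IsGalois ℚ F], 6 ≤ Module.finrank ℚ F → ∀ (Φ : CMType F) (ι₁ : F →+* ℂ), ι₁ ∈ Φ.1 →
      ∀ (V : HermSpace3 F ι₁) (Dμ : (D F ι₁ V Φ).Obj),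
        ∃ X : Def45.CMDatum (AlgHom.id ℚ F) ι₁ (D F ι₁ V Φ).isConjugateSymplectic (D F ι₁ V Φ).hasWeight_one
          (C F ι₁ V Φ), X.A = Aμ₀ F ι₁ V Φ Dμ)
    (hComp : ∀ (F : CMField), IsGalois ℚ F → 6 ≤ Module.finrank ℚ F → ∀ (Φ : CMType F) (ι₁ : F →+* ℂ), ι₁ ∈ Φ.1 →
      ∀ V : HermSpace3 F ι₁, ∃ Ksm : Subgroup (D F ι₁ V Φ).G, IsOpenCompact Ksm ∧
        ∀ K : Subgroup (D F ι₁ V Φ).G, IsOpenCompact K → K ≤ Ksm →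
          ∃ (C : Type) (_ : Fintype C) (X : C → SchemeOver ℂ) (B : ∀ c, UnitaryBallUniformisationDatum 2 (X c))
            (Γ : C → Level V) (𝒥 : ∀ c, Jacobian (X c))
            (π : ∀ c, (letI := ι₁.toAlgebra; (AK F ι₁ V Φ K).baseChange ℂ) ⟶ (𝒥 c).J),
            (∀ c, (B c).Hℂ = V.Hm.map ι₁) ∧
            (∀ c, (B c).Γ.map (Matrix.GeneralLinearGroup.map (B c).τ₁) =
              (Γ c).Γ.map (Matrix.GeneralLinearGroup.map ι₁)) ∧
            Nonempty (IsLimit (Fan.mk (letI := ι₁.toAlgebra; (AK F ι₁ V Φ K).baseChange ℂ) π)))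
    (hD : ∀ (F : CMField), IsGalois ℚ F → 6 ≤ Module.finrank ℚ F → ∀ (f : Face F) (ι₁ : F →+* ℂ), f.Admissible ι₁ →
      ∀ V : HermSpace3 F ι₁,
        ∃ (HG : Type) (_ : NormedAddCommGroup HG) (_ : InnerProductSpace ℂ HG)
          (emb : ∀ Γ : Level V, U.CohC (U.pms F ι₁ V Γ) 2 →ₗ[ℂ] HG)
          (cover : ∀ (Γ Γ' : Level V), Γ' ≤ Γ → U.Mor (U.pms F ι₁ V Γ') (U.pms F ι₁ V Γ)),
          (∀ (Γ : Level V) (ω₁ ω₂ : U.CohC (U.pms F ι₁ V Γ) 1), ω₁ ∈ U.Uiso Γ F (f.psi 0) ι₁ → ω₂ ∈ U.Uiso Γ F (f.psi 1) ι₁ →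
            emb Γ (U.cup2C (U.pms F ι₁ V Γ) 1 ω₁ ω₂) ∈ (Submodule.span ℂ
              {x : HG | ∃ (Γ' : Level V), ∃ ω₃ ∈ U.Uiso Γ' F (f.psi 2) ι₁, ∃ ω₄ ∈ U.Uiso Γ' F (f.psi 3) ι₁,
                x = emb Γ' (U.cup2C (U.pms F ι₁ V Γ') 1 ω₃ ω₄)}).topologicalClosure) ∧
          (∀ (Γ Γ' : Level V) (hle : Γ' ≤ Γ) (x : U.CohC (U.pms F ι₁ V Γ) 2),
            emb Γ' (U.pullC (cover Γ Γ' hle) 2 x) = emb Γ x) ∧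
          (∀ Γ : Level V, ∃ c : ℂ, c ≠ 0 ∧ ∀ x y : U.CohC (U.pms F ι₁ V Γ) 2,
            x ∈ (U.hodge (U.pms F ι₁ V Γ) 2).F 2 → y ∈ (U.hodge (U.pms F ι₁ V Γ) 2).F 2 →
              ⟪emb Γ y, emb Γ x⟫_ℂ = c * U.trC (U.pms F ι₁ V Γ) 4 (U.cup2C (U.pms F ι₁ V Γ) 2 x (conj y)))) :
    HC_CM := by
  subst hU
  exact hc_cm_of_supply_of_dictionary_of_eq _ rfl
    (exists_supplyWitness_of_faceSupply _ _ _ _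
      (faceSupply_of_thm418AsPrinted_pinnedE_def45Reading _ _ _ _ D Aμ₀ AK homE hE hLiu hObj hChi hirr hsm hμ C hAμ hComp)) hD

end Display

end Summit.HodgeConjecture.CorCM.Model

end
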